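import Mathlib.MeasureTheory.Integral.Lebesgue.Basic
import Mathlib.MeasureTheory.Measure.Lebesgue.Basic
import Mathlib.Analysis.SpecialFunctions.Log.Deriv
import Mathlib.Analysis.Real.Sqrt
import Mathlib.Analysis.Calculus.Deriv.Inv
import HarnessLib

/-!
# Photon-sphere capacity of a static spherically symmetric black hole dressed with massless matter

Real-variable vocabulary (no manifold machinery) for the null/eikonal potential of a static,
spherically symmetric spacetime
`ds² = -e^{2ν(r)} dt² + dr²/(1 - 2m(r)/r) + r² dΩ²` in Schwarzschild (area-radius) coordinates,
and for the WKB (Bohr–Sommerfeld) phase volume of its potential wells.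

## Main definitions (namespace `Literature.Geometry.Lorentzian.StaticShell`)

* `IsSolution Mbh η m ν ρ p q` — the ODE class: a Schwarzschild interior of mass `Mbh`
  surrounded, on `r > 2 Mbh`, by static anisotropic *massless* (trace-free, `ρ = p + 2q`) matter of
  total mass `≤ (1 + η) Mbh`, with a vacuum gap above the horizon:
  `m' = 4πr²ρ`, `ν' = (m + 4πr³p)/(r(r - 2m))`, the anisotropic Tolman–Oppenheimer–Volkoff equation
  `p' = -(ρ + p)ν' + 2(q - p)/r`, `ρ, p, q ≥ 0`, `2m < r`. This is the reduced static
  Einstein–matter system of Andréasson (AHP 22 (2021), §2, with `μ = ν`, `e^{-2λ} = 1 - 2m/r`),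
  of which the static massless Einstein–Vlasov shells are the kinetic sub-class.
* `nullPotential ν r = e^{2ν(r)}/r²` — the potential of null geodesics / of the master wave
  equation in the eikonal regime (`V_{sl} ~ l² f/r²`, `f = e^{2ν}`), and
  `tortoiseDensity m ν r = e^{-ν(r)}/√(1 - 2m(r)/r) = dr*/dr` (Brito–Cardoso–Pani, App. F).
* `wellDepth ν r₁ rb r₂ = min (V r₁) (V r₂) - V rb`.
* `phaseIntegrand`, `wellPhase m ν r₁ r₂ = ∫_{r₁}^{r₂} √((min (V r₁) (V r₂) - V r)₊) dr*` — the
  `n = 0` Bohr–Sommerfeld action available in `[r₁, r₂]` below the lower of the two endpoint values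
  (Brito–Cardoso–Pani, App. F, eq. (F.5)), valued in `ℝ≥0∞`.
* `capacity Mbh m ν = ⨆_{2Mbh < r₁ < r₂} wellPhase m ν r₁ r₂` (the *photon-sphere capacity* `𝒮`)
  and `selfTrappingThreshold Mbh m ν = π/(2𝒮)` (the *self-trapping threshold* `ℓ*`): with
  `ω = L w`, `L = ℓ + ½`, the eikonal WKB condition `L ∫ √(w² - V) dr* = π(n + ½)` has an `n = 0`
  solution below the barrier tops only if `L 𝒮 ≥ π/2`, i.e. `L ≥ ℓ*`.
* Sanity API: `schwarzschildPotential`, its photon-sphere value `1/(27M²)` and second-order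
  flatness there, `IsSolution.schwarzschild` (non-vacuity of the class), `capacity_eq_zero_iff`,
  `capacity_schwarzschild` / `selfTrappingThreshold_schwarzschild` (a bare Schwarzschild exterior has
  no potential well: zero capacity, infinite threshold — "the horizon forbids trapped modes",
  Brito–Cardoso–Pani §4.14.2).

## References

* R. Brito, V. Cardoso, P. Pani, *Superradiance*, Lect. Notes Phys. 971, Springer 2020,
  §4.14.2 and Appendix F (eqs. (F.1), (F.5)) — key `BritoCardosoPani2020`.
* H. Andréasson, *Existence of steady states of the massless Einstein–Vlasov system surrounding a
  Schwarzschild black hole*, Ann. Henri Poincaré 22 (2021) 4271–4297, §2 — key `Andreasson2021`.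
* J. Keir, *Slowly decaying waves on spherically symmetric spacetimes and ultracompact neutron
  stars*, Class. Quantum Grav. 33 (2016) 135009 (wave equations and stable trapping on static
  spherically symmetric backgrounds) — key `Keir2016`.

## Design choices

* Everything is a total function of raw real data `(Mbh, η, m, ν, ρ, p, q)`; the fields of
  `IsSolution` are *verbatim* the hypotheses of the requesting statement (route
  PhotonSphereCapacity, item `CapacityLaw`), so a curried hypothesis list is bridged by the
  anonymous constructor.
* `wellPhase`, `capacity`, `selfTrappingThreshold` are valued in `ℝ≥0∞` (lower Lebesgue integral,
  `⨆`, and `ENNReal` division with `π/0 = ∞`, `π/∞ = 0`): no integrability or boundedness side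
  condition is hidden, an infinitely large well has capacity `∞` (not a junk `0`), zero capacity
  means threshold `∞` (nothing self-traps) and infinite capacity means threshold `0`.
* The positive part `(E - V)₊` is implemented by `Real.sqrt`, which vanishes on `(-∞, 0]`.
* The supremum runs over *all* pairs `2Mbh < r₁ < r₂`; the integrand vanishes unless `V` dips
  below both endpoint values, so only genuine wells contribute (`wellPhase_eq_zero_of_le`).
* Junk values: `tortoiseDensity m ν r = 0` where `2m(r) ≥ r` (`Real.sqrt` of a non-positive
  number and division by zero); inside the class `2m < r` holds and the density is positive
  (`tortoiseDensity_pos`). `nullPotential ν 0 = 0` by `x/0 = 0`; irrelevant on `r > 2Mbh > 0`.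
* The names *capacity* and *self-trapping threshold* are those of the requesting programme; the
  sources only supply the WKB phase (F.5) and the eikonal potential.

## Not here

Existence of matter shells (Andréasson's Theorem 1 would be a separate cited fact), any WKB /
Agmon resonance theorem, the `η²` capacity law, and the Kerr (axisymmetric) version.
-/

noncomputable section

open MeasureTheory Set
open scoped ENNReal

namespace Literature.Geometry.Lorentzian

namespace StaticShell

/-! ## The ODE class -/

/-- The static, spherically symmetric black-hole-plus-massless-matter configurations, as raw real
functions of the area radius `r` on the exterior `r > 2 Mbh` of a Schwarzschild interior of mass
`Mbh`: mass function `m`, metric potential `ν` (`g_tt = -e^{2ν}`, `g_rr = (1 - 2m/r)⁻¹`), energy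
density `ρ`, radial pressure `p`, tangential pressure `q`, subject to
`m' = 4πr²ρ`, `ν' = (m + 4πr³p)/(r(r - 2m))`, the anisotropic TOV equation
`p' = -(ρ + p)ν' + 2(q - p)/r`, `ρ, p, q ≥ 0`, trace-free matter `ρ = p + 2q`, no horizon `2m < r`,
total mass `m ≤ (1 + η) Mbh` (mass fraction `η` outside the hole), and a vacuum gap
`m = Mbh, ρ = p = 0` on some `(2Mbh, R₁]`. The fields are verbatim the hypotheses of the route item
`CapacityLaw` (Summits/FinalStateConjecture, route PhotonSphereCapacity). This is the reduced static
Einstein–matter system in Schwarzschild coordinates with `μ = ν`, `e^{-2λ} = 1 - 2m/r`,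
`p_T = q`; static massless Einstein–Vlasov shells satisfy it.
[cite: Andreasson2021, §2] -/
structure IsSolution (Mbh η : ℝ) (m ν ρ p q : ℝ → ℝ) : Prop where
  /-- `m' = 4π r² ρ` on `r > 2 Mbh`. -/
  hasDerivAt_mass : ∀ r, 2 * Mbh < r → HasDerivAt m (4 * Real.pi * r ^ 2 * ρ r) r
  /-- `ν' = (m + 4π r³ p) / (r (r - 2m))` on `r > 2 Mbh`. -/
  hasDerivAt_potential : ∀ r, 2 * Mbh < r →
    HasDerivAt ν ((m r + 4 * Real.pi * r ^ 3 * p r) / (r * (r - 2 * m r))) r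
  /-- The anisotropic Tolman–Oppenheimer–Volkoff equation `p' = -(ρ + p) ν' + 2 (q - p) / r`. -/
  hasDerivAt_pressure : ∀ r, 2 * Mbh < r →
    HasDerivAt p (-(ρ r + p r) * ((m r + 4 * Real.pi * r ^ 3 * p r) / (r * (r - 2 * m r)))
      + 2 * (q r - p r) / r) r
  /-- Non-negative, trace-free matter, no horizon, total mass at most `(1 + η) Mbh`. -/
  matter : ∀ r, 2 * Mbh < r →
    0 ≤ ρ r ∧ 0 ≤ p r ∧ 0 ≤ q r ∧ ρ r = p r + 2 * q r ∧ 2 * m r < r ∧ m r ≤ (1 + η) * Mbh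
  /-- A vacuum gap above the horizon. -/
  vacuumGap : ∃ R₁, 2 * Mbh < R₁ ∧ ∀ r, 2 * Mbh < r → r ≤ R₁ → m r = Mbh ∧ ρ r = 0 ∧ p r = 0

/-! ## Null potential, tortoise density, well depth -/

/-- The null (eikonal) potential `V(r) = e^{2ν(r)} / r²` of the static spherically symmetric metric
`-e^{2ν} dt² + dr²/(1 - 2m/r) + r² dΩ²`: null geodesics have turning points where
`b⁻² = V` (`b` the impact parameter), circular photon orbits sit at critical points of `V`, and the
master wave equation has potential `l² V + O(1)` in the eikonal regime `l → ∞`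
(`V_{sl} ~ l² f / r²` with `f = e^{2ν}`). Junk value `V 0 = 0`.
[cite: BritoCardosoPani2020, App. F eq. (F.1) and the eikonal limit before eq. (F.5)] -/
def nullPotential (ν : ℝ → ℝ) (r : ℝ) : ℝ :=
  Real.exp (2 * ν r) / r ^ 2

/-- The tortoise density `dr*/dr = e^{-ν(r)} / √(1 - 2 m(r)/r)` (`dr/dr* = √(f/B)` with
`f = e^{2ν}`, `B = (1 - 2m/r)⁻¹`). Junk value `0` where `2 m(r) ≥ r`.
[cite: BritoCardosoPani2020, App. F text after eq. (F.1)] -/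
def tortoiseDensity (m ν : ℝ → ℝ) (r : ℝ) : ℝ :=
  Real.exp (-ν r) / Real.sqrt (1 - 2 * m r / r)

/-- The depth of the potential well with tops at `r₁`, `r₂` and bottom at `rb`:
`min (V r₁) (V r₂) - V rb` (non-positive when `(r₁, rb, r₂)` is not a genuine well). [folklore] -/
def wellDepth (ν : ℝ → ℝ) (r₁ rb r₂ : ℝ) : ℝ :=
  min (nullPotential ν r₁) (nullPotential ν r₂) - nullPotential ν rb

/-! ## WKB phase volume, capacity, threshold -/

/-- The WKB phase integrand at level `E`, per unit area radius:
`√((E - V(r))₊) · dr*/dr` (`Real.sqrt` vanishes on non-positive numbers, which implements the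
positive part: only the classically allowed region `V < E` contributes).
[cite: BritoCardosoPani2020, App. F eq. (F.5)] -/
def phaseIntegrand (m ν : ℝ → ℝ) (E r : ℝ) : ℝ :=
  Real.sqrt (E - nullPotential ν r) * tortoiseDensity m ν r

/-- The WKB (Bohr–Sommerfeld, `n = 0`) phase volume of the radial interval `[r₁, r₂]` at the level
of the lower endpoint value, `∫_{r₁}^{r₂} √((min (V r₁) (V r₂) - V r)₊) dr*`, as a lower Lebesgue
integral in `ℝ≥0∞` (dimensionless). It vanishes unless `V` dips below both endpoint values inside
`(r₁, r₂)` (`wellPhase_eq_zero_of_le`). In the eikonal regime the condition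
`L · ∫ √(w² - V) dr* = π (n + ½)` (`ω = L w`) is eq. (F.5) of the source.
[cite: BritoCardosoPani2020, App. F eq. (F.5)] -/
def wellPhase (m ν : ℝ → ℝ) (r₁ r₂ : ℝ) : ℝ≥0∞ :=
  ∫⁻ r in Ioo r₁ r₂,
    ENNReal.ofReal (phaseIntegrand m ν (min (nullPotential ν r₁) (nullPotential ν r₂)) r)

/-- The **photon-sphere capacity** `𝒮` of the exterior `r > 2 Mbh`: the supremum over all pairs
`2 Mbh < r₁ < r₂` of the WKB phase volume `wellPhase m ν r₁ r₂`, i.e. the largest `n = 0`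
Bohr–Sommerfeld action available to a quasi-bound state below the confining barrier tops of any
well of the null potential (value in `ℝ≥0∞`; `∞` for an unboundedly large well, `0` when `V` has
no well, `capacity_eq_zero_iff`). Terminology of the requesting programme (route
PhotonSphereCapacity); the phase is that of eq. (F.5) of the source.
[cite: BritoCardosoPani2020, App. F eq. (F.5)] -/
def capacity (Mbh : ℝ) (m ν : ℝ → ℝ) : ℝ≥0∞ :=
  ⨆ (r₁ : ℝ) (r₂ : ℝ) (_ : 2 * Mbh < r₁ ∧ r₁ < r₂), wellPhase m ν r₁ r₂

/-- The **self-trapping threshold** `ℓ* = π / (2 𝒮)`: the smallest eikonal frequency parameter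
`L` for which the `n = 0` Bohr–Sommerfeld condition `L · (phase) = π/2` of eq. (F.5) can be met in
some well of the null potential; `∞` when the capacity vanishes (`ENNReal` division, `π/0 = ∞`),
`0` when it is infinite. Terminology of the requesting programme (route PhotonSphereCapacity).
[cite: BritoCardosoPani2020, App. F eq. (F.5)] -/
def selfTrappingThreshold (Mbh : ℝ) (m ν : ℝ → ℝ) : ℝ≥0∞ :=
  ENNReal.ofReal Real.pi / (2 * capacity Mbh m ν)

/-! ## Basic API -/

/-- The null potential is positive away from `r = 0`. [folklore] -/
theorem nullPotential_pos (ν : ℝ → ℝ) {r : ℝ} (hr : r ≠ 0) : 0 < nullPotential ν r :=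
  div_pos (Real.exp_pos _) (by positivity)

/-- The tortoise density is non-negative (junk value `0` included). [folklore] -/
theorem tortoiseDensity_nonneg (m ν : ℝ → ℝ) (r : ℝ) : 0 ≤ tortoiseDensity m ν r :=
  div_nonneg (Real.exp_pos _).le (Real.sqrt_nonneg _)

/-- Outside horizons (`0 < r`, `2 m(r) < r`) the tortoise density is positive. [folklore] -/
theorem tortoiseDensity_pos (m ν : ℝ → ℝ) {r : ℝ} (hr : 0 < r) (hm : 2 * m r < r) :
    0 < tortoiseDensity m ν r := by
  unfold tortoiseDensity
  refine div_pos (Real.exp_pos _) (Real.sqrt_pos.2 ?_)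
  rw [sub_pos, div_lt_one hr]
  exact hm

/-- Relative form of a well-depth bound: `depth ≤ δ · V(bottom)` iff
`min (V r₁) (V r₂) ≤ (1 + δ) · V(bottom)` (the shape of the conclusion of `CapacityLaw`).
[folklore] -/
theorem wellDepth_le_iff (ν : ℝ → ℝ) (r₁ rb r₂ δ : ℝ) :
    wellDepth ν r₁ rb r₂ ≤ δ * nullPotential ν rb ↔
      min (nullPotential ν r₁) (nullPotential ν r₂) ≤ (1 + δ) * nullPotential ν rb := by
  unfold wellDepth
  rw [add_mul, one_mul]
  constructor <;> intro h <;> linarith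

/-- The well depth is non-positive exactly when the "bottom" is not below both tops. [folklore] -/
theorem wellDepth_nonpos_iff (ν : ℝ → ℝ) (r₁ rb r₂ : ℝ) :
    wellDepth ν r₁ rb r₂ ≤ 0 ↔
      min (nullPotential ν r₁) (nullPotential ν r₂) ≤ nullPotential ν rb := by
  unfold wellDepth
  exact sub_nonpos

/-- The phase integrand is non-negative. [folklore] -/
theorem phaseIntegrand_nonneg (m ν : ℝ → ℝ) (E r : ℝ) : 0 ≤ phaseIntegrand m ν E r :=
  mul_nonneg (Real.sqrt_nonneg _) (tortoiseDensity_nonneg m ν r)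

/-- Outside the classically allowed region (`E ≤ V r`) the phase integrand vanishes. [folklore] -/
theorem phaseIntegrand_eq_zero (m ν : ℝ → ℝ) {E r : ℝ} (h : E ≤ nullPotential ν r) :
    phaseIntegrand m ν E r = 0 := by
  unfold phaseIntegrand
  rw [Real.sqrt_eq_zero'.2 (sub_nonpos.2 h), zero_mul]

/-- No dip below the endpoint level inside `(r₁, r₂)` means zero phase volume. [folklore] -/
theorem wellPhase_eq_zero_of_le (m ν : ℝ → ℝ) {r₁ r₂ : ℝ}
    (h : ∀ r ∈ Ioo r₁ r₂, min (nullPotential ν r₁) (nullPotential ν r₂) ≤ nullPotential ν r) :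
    wellPhase m ν r₁ r₂ = 0 := by
  unfold wellPhase
  refine setLIntegral_eq_zero measurableSet_Ioo fun r hr ↦ ?_
  simp [phaseIntegrand_eq_zero m ν (h r hr)]

/-- Every admissible pair contributes to the capacity. [folklore] -/
theorem wellPhase_le_capacity (Mbh : ℝ) (m ν : ℝ → ℝ) {r₁ r₂ : ℝ} (h₁ : 2 * Mbh < r₁)
    (h₂ : r₁ < r₂) : wellPhase m ν r₁ r₂ ≤ capacity Mbh m ν := by
  unfold capacity
  exact le_iSup_of_le r₁ (le_iSup_of_le r₂ (le_iSup_of_le ⟨h₁, h₂⟩ le_rfl))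

/-- The capacity vanishes iff every admissible pair has zero phase volume. [folklore] -/
theorem capacity_eq_zero_iff (Mbh : ℝ) (m ν : ℝ → ℝ) :
    capacity Mbh m ν = 0 ↔ ∀ r₁ r₂ : ℝ, 2 * Mbh < r₁ → r₁ < r₂ → wellPhase m ν r₁ r₂ = 0 := by
  simp only [capacity, ENNReal.iSup_eq_zero, and_imp]

/-- A potential without wells on `r > 2 Mbh` (on every sub-interval the minimum is attained at an
endpoint) has zero capacity. [folklore] -/
theorem capacity_eq_zero_of_forall_le (Mbh : ℝ) (m ν : ℝ → ℝ)
    (h : ∀ r₁ r r₂ : ℝ, 2 * Mbh < r₁ → r₁ < r → r < r₂ →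
      min (nullPotential ν r₁) (nullPotential ν r₂) ≤ nullPotential ν r) :
    capacity Mbh m ν = 0 :=
  (capacity_eq_zero_iff Mbh m ν).2 fun _r₁ _r₂ h₁ _ ↦
    wellPhase_eq_zero_of_le m ν fun r hr ↦ h _ r _ h₁ hr.1 hr.2

/-- Zero capacity is the same as an infinite self-trapping threshold (nothing self-traps).
[folklore] -/
theorem selfTrappingThreshold_eq_top_iff (Mbh : ℝ) (m ν : ℝ → ℝ) :
    selfTrappingThreshold Mbh m ν = ∞ ↔ capacity Mbh m ν = 0 := by
  have hπ : ENNReal.ofReal Real.pi ≠ 0 := by simpa using Real.pi_pos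
  simp [selfTrappingThreshold, ENNReal.div_eq_top, hπ]

/-- Infinite capacity is the same as a zero self-trapping threshold. [folklore] -/
theorem selfTrappingThreshold_eq_zero_iff (Mbh : ℝ) (m ν : ℝ → ℝ) :
    selfTrappingThreshold Mbh m ν = 0 ↔ capacity Mbh m ν = ∞ := by
  have hπ : ENNReal.ofReal Real.pi ≠ 0 := by simpa using Real.pi_pos
  simp [selfTrappingThreshold, ENNReal.div_eq_zero_iff, hπ, ENNReal.mul_eq_top]

/-! ## The Schwarzschild exterior -/

/-- The Schwarzschild null potential `V_M(r) = (1 - 2M/r) / r²`. [folklore] -/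
def schwarzschildPotential (M r : ℝ) : ℝ :=
  (1 - 2 * M / r) / r ^ 2

/-- With `e^{2ν} = 1 - 2M/r`, i.e. `ν = ½ log (1 - 2M/r)`, the null potential is Schwarzschild's.
[folklore] -/
theorem nullPotential_schwarzschild {M r : ℝ} (hM : 0 ≤ M) (hr : 2 * M < r) :
    nullPotential (fun s ↦ Real.log (1 - 2 * M / s) / 2) r = schwarzschildPotential M r := by
  unfold nullPotential schwarzschildPotential
  have hr0 : 0 < r := by linarith
  have h : 0 < 1 - 2 * M / r := by
    rw [sub_pos, div_lt_one hr0]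
    exact hr
  have h2 : 2 * (Real.log (1 - 2 * M / r) / 2) = Real.log (1 - 2 * M / r) := by ring
  rw [h2, Real.exp_log h]

/-- The photon-sphere value `V_M(3M) = 1/(27 M²)`. [folklore] -/
theorem schwarzschildPotential_photonSphere {M : ℝ} (hM : M ≠ 0) :
    schwarzschildPotential M (3 * M) = 1 / (27 * M ^ 2) := by
  unfold schwarzschildPotential
  field_simp
  ring

/-- Second-order flatness of the Schwarzschild potential at the photon sphere:
`1/(27M²) - V_M(3M(1 + x)) = x² (3 + x) / (27 M² (1 + x)³)` — the photon orbit is a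
non-degenerate maximum, so a perturbation of relative size `η` can only carve a well of relative
depth `O(η²)`. [folklore] -/
theorem schwarzschildPotential_flatness {M x : ℝ} (hM : M ≠ 0) (hx : x ≠ -1) :
    1 / (27 * M ^ 2) - schwarzschildPotential M (3 * M * (1 + x)) =
      x ^ 2 * (3 + x) / (27 * M ^ 2 * (1 + x) ^ 3) := by
  unfold schwarzschildPotential
  have hx' : 1 + x ≠ 0 := fun h ↦ hx (by linarith)
  field_simp
  ring

/-- The Schwarzschild potential increases on `(0, 3M]` … [folklore] -/
theorem schwarzschildPotential_mono {M a b : ℝ} (ha : 0 < a) (hab : a ≤ b) (hb : b ≤ 3 * M) :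
    schwarzschildPotential M a ≤ schwarzschildPotential M b := by
  unfold schwarzschildPotential
  have hb0 : 0 < b := lt_of_lt_of_le ha hab
  rw [div_le_div_iff₀ (by positivity) (by positivity)]
  have e1 : (1 - 2 * M / a) * b ^ 2 = (a - 2 * M) * b ^ 2 / a := by field_simp
  have e2 : (1 - 2 * M / b) * a ^ 2 = (b - 2 * M) * a ^ 2 / b := by field_simp
  rw [e1, e2, div_le_div_iff₀ ha hb0]
  -- (a - 2M) b³ ≤ (b - 2M) a³
  have key : (b - 2 * M) * a ^ 2 * a - (a - 2 * M) * b ^ 2 * b =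
      (b - a) * (2 * M * (a ^ 2 + a * b + b ^ 2) - a * b * (a + b)) := by ring
  have h1 : 0 ≤ b - a := sub_nonneg.2 hab
  have h2 : 0 ≤ 2 * M * (a ^ 2 + a * b + b ^ 2) - a * b * (a + b) := by
    have h3 : b / 3 ≤ M := by linarith
    have h4 : 0 ≤ (b - a) * (2 * b + a) := mul_nonneg h1 (by linarith)
    nlinarith [mul_le_mul_of_nonneg_right h3 (show 0 ≤ 2 * (a ^ 2 + a * b + b ^ 2) by positivity)]
  nlinarith [mul_nonneg h1 h2]

/-- … and decreases on `[3M, ∞)`. [folklore] -/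
theorem schwarzschildPotential_anti {M a b : ℝ} (hM : 0 ≤ M) (ha : 3 * M ≤ a) (ha0 : 0 < a)
    (hab : a ≤ b) : schwarzschildPotential M b ≤ schwarzschildPotential M a := by
  unfold schwarzschildPotential
  have hb0 : 0 < b := lt_of_lt_of_le ha0 hab
  rw [div_le_div_iff₀ (by positivity) (by positivity)]
  have e1 : (1 - 2 * M / b) * a ^ 2 = (b - 2 * M) * a ^ 2 / b := by field_simp
  have e2 : (1 - 2 * M / a) * b ^ 2 = (a - 2 * M) * b ^ 2 / a := by field_simp
  rw [e1, e2, div_le_div_iff₀ hb0 ha0]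
  have key : (a - 2 * M) * b ^ 2 * b - (b - 2 * M) * a ^ 2 * a =
      (b - a) * (a * b * (a + b) - 2 * M * (a ^ 2 + a * b + b ^ 2)) := by ring
  have h1 : 0 ≤ b - a := sub_nonneg.2 hab
  have h2 : 0 ≤ a * b * (a + b) - 2 * M * (a ^ 2 + a * b + b ^ 2) := by
    have h3 : M ≤ a / 3 := by linarith
    have h4 : 0 ≤ (b - a) * (b + 2 * a) := mul_nonneg h1 (by linarith)
    nlinarith [mul_le_mul_of_nonneg_right h3 (show 0 ≤ 2 * (a ^ 2 + a * b + b ^ 2) by positivity)]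
  nlinarith [mul_nonneg h1 h2]

/-- The Schwarzschild potential has no well: on every interval in `r > 0` its minimum is attained
at an endpoint. [folklore] -/
theorem schwarzschildPotential_min_le {M r₁ r r₂ : ℝ} (hM : 0 ≤ M) (h₀ : 0 < r₁) (h₁ : r₁ ≤ r)
    (h₂ : r ≤ r₂) :
    min (schwarzschildPotential M r₁) (schwarzschildPotential M r₂) ≤ schwarzschildPotential M r := by
  rcases le_total r (3 * M) with hr | hr
  · exact (min_le_left _ _).trans (schwarzschildPotential_mono h₀ h₁ hr)
  · exact (min_le_right _ _).trans
      (schwarzschildPotential_anti hM hr (lt_of_lt_of_le h₀ h₁) h₂)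

/-- **Non-vacuity of the class**: the bare Schwarzschild exterior of mass `Mbh > 0`
(`m ≡ Mbh`, `ν = ½ log(1 - 2Mbh/r)`, no matter) is an `IsSolution` for every `η ≥ 0`. [folklore] -/
theorem IsSolution.schwarzschild {Mbh η : ℝ} (hM : 0 < Mbh) (hη : 0 ≤ η) :
    IsSolution Mbh η (fun _ ↦ Mbh) (fun r ↦ Real.log (1 - 2 * Mbh / r) / 2) 0 0 0 where
  hasDerivAt_mass r _ := by simpa using hasDerivAt_const r Mbh
  hasDerivAt_potential r hr := by
    have hr0 : 0 < r := by linarith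
    have hr0' : r ≠ 0 := hr0.ne'
    have h1 : 0 < 1 - 2 * Mbh / r := by
      rw [sub_pos, div_lt_one hr0]
      exact hr
    have h1' : 1 - 2 * Mbh / r ≠ 0 := h1.ne'
    have h2 : r - 2 * Mbh ≠ 0 := (sub_pos.2 hr).ne'
    have hd : HasDerivAt (fun s : ℝ ↦ 1 - 2 * Mbh / s) (2 * Mbh / r ^ 2) r := by
      refine (((hasDerivAt_const r (2 * Mbh)).fun_div (hasDerivAt_id' r) hr0').const_sub 1
        ).congr_deriv ?_
      ring
    refine ((hd.log h1').div_const 2).congr_deriv ?_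
    simp only [Pi.zero_apply, mul_zero, add_zero]
    field_simp
  hasDerivAt_pressure r _ := by simp
  matter r hr := by
    refine ⟨le_rfl, le_rfl, le_rfl, by simp, hr, ?_⟩
    nlinarith
  vacuumGap := ⟨2 * Mbh + 1, by linarith, fun _ _ _ ↦ ⟨rfl, rfl, rfl⟩⟩

/-- **A bare black hole traps nothing stably**: the Schwarzschild exterior has zero photon-sphere
capacity (its null potential has a single barrier and no well; "the presence of the horizon forbids
the existence of trapped modes"). [cite: BritoCardosoPani2020, §4.14.2] -/
theorem capacity_schwarzschild {Mbh : ℝ} (hM : 0 < Mbh) :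
    capacity Mbh (fun _ ↦ Mbh) (fun r ↦ Real.log (1 - 2 * Mbh / r) / 2) = 0 := by
  refine capacity_eq_zero_of_forall_le Mbh _ _ fun r₁ r r₂ h₁ hr hr₂ ↦ ?_
  have h₀ : 0 < r₁ := by linarith
  rw [nullPotential_schwarzschild hM.le h₁, nullPotential_schwarzschild hM.le (by linarith),
    nullPotential_schwarzschild hM.le (by linarith)]
  exact schwarzschildPotential_min_le hM.le h₀ hr.le hr₂.le

/-- … equivalently, its self-trapping threshold is infinite. [folklore] -/
theorem selfTrappingThreshold_schwarzschild {Mbh : ℝ} (hM : 0 < Mbh) :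
    selfTrappingThreshold Mbh (fun _ ↦ Mbh) (fun r ↦ Real.log (1 - 2 * Mbh / r) / 2) = ∞ :=
  (selfTrappingThreshold_eq_top_iff _ _ _).2 (capacity_schwarzschild hM)

end StaticShell

end Literature.Geometry.Lorentzian
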